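import Summits.CriticalPhenomena.PercolationContinuityZ3.Theorems.PercNearOneGluingNoHeavyLowerTailSahiInterpDP
import Summits.CriticalPhenomena.PercolationContinuityZ3.Theorems.PercNearOneGluingNoHeavyLowerTailSahiInterpGrid
import Summits.CriticalPhenomena.PercolationContinuityZ3.Theorems.PercNearOneGluingNoHeavyLowerTailSahiInterpSym

/-!
# The interpolation leaf test for Sahi's `E_n` on `{0,1}^m`, VIII: SOUNDNESS OF THE LEAF TEST `testI`

Support file (cell `prim-sahi`, seat `prim-sahi-typer` gen 30; `--supports stmt-CriticalPhenomena-4575`).  Pure proofs; standard axioms, no `sorry`.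

* `size_transformA`; **`gridArr_eq_sum`** — for a family passing `symFam`, the grid table holds at `key x` the INTEGER
  `Σ_k γ_k Π_i B_{x_i,k_i}`, `γ = NCopyCert.sahiCoef m n (encA ∘ A)` (parts III, IV, VII + `NCopyCert.evB_sahiCoef` + `evB_grid`: both sides are
  `n^{m n} · E_n(μ_{x/n}; A)` as reals);
* **`transformA_gridArr_eq`** — the transform of the grid table is `c^m · γ` (parts II);
* **`testI_sound`** — `testI m n H c (encA ∘ A) = true → ∀ p, 0 ≤ E_n(μ_p; 1_{A_0}, …, 1_{A_{n−1}})`: all `γ_K ≥ 0`, hence `evB n γ ≥ 0` on the cube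
  (`NCopyCert.evB_nonneg`).  This is exactly the leaf-test hypothesis of …`SahiSymCubeSound.sahiPositive_of_symCheckT`. [this work]
-/

namespace Summit.CriticalPhenomena.PercolationContinuityZ3.Theorems.SahiInterp

open Finset OneCutCert SahiC3Cube NCopyCert SahiSymCube

/-! ## Soundness of the leaf test -/

section Sound

open Literature.Combinatorics.Sahi2008 (ex sahiE bernoulliWeight)
open Literature.Probability.Percolation.DecisionTree (ind)

/-- The transform has `(d+1)^m` entries. [this work] -/
theorem size_transformA (d : ℕ) (H : Fin (d + 1) → Fin (d + 1) → ℤ) : ∀ (m : ℕ) (Z : Array ℤ), (transformA d H m Z).size = (d + 1) ^ m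
  | 0, Z => by simp [transformA]
  | m + 1, Z => by rw [transformA]; exact Array.size_ofFn

/-- **The grid table holds the Bernstein combinations**: `gridArr[key x] = Σ_k γ_k Π_i B_{x_i,k_i}` with `γ = sahiCoef m n (encA ∘ A)`, for a
family passing the symmetry check (`0 < n`). [this work] -/
theorem gridArr_eq_sum {m n : ℕ} (hn : 0 < n) (A : Fin n → Set (Set (Fin m))) (hsym : symFam m n (fun i => encA m (A i)) = true)
    (x : Fin m → Fin (n + 1)) :
    (gridArr m n (fun i => encA m (A i))).getD (enc x) 0 =
      ∑ k : Fin m → Fin (n + 1), sahiCoef m n (fun i => encA m (A i)) k * ∏ i, bMat n (x i) (k i) := by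
  obtain ⟨σ, hσ⟩ := gridArr_getD m n (fun i => encA m (A i)) x
  have hxv : ∀ j, (fun j => ((x j : Fin (n + 1)) : ℕ)) j ≤ n := fun j => Nat.lt_succ_iff.1 (x j).isLt
  have hx' : ∀ j, (fun j => ((x (σ j) : Fin (n + 1)) : ℕ)) j ≤ n := fun j => Nat.lt_succ_iff.1 (x (σ j)).isLt
  apply Int.cast_injective (α := ℝ)
  rw [hσ, zVal_eq hn hn A _ hx']
  have hperm : gridP n (fun j => ((x (σ j) : Fin (n + 1)) : ℕ)) hx' = (gridP n (fun j => ((x j : Fin (n + 1)) : ℕ)) hxv) ∘ σ := by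
    funext j; rfl
  rw [hperm, sahiE_perm_of_symFam A hsym σ, ← evB_sahiCoef, ← evB_grid hn]
  have hp : (fun i => ((gridP n (fun j => ((x j : Fin (n + 1)) : ℕ)) hxv i : unitInterval) : ℝ)) = fun i => (((x i : Fin (n + 1)) : ℕ) : ℝ) / n := by
    funext i; rfl
  rw [hp, ← pow_mul, ← pow_mul, mul_comm m n]

/-- **The transform of the grid table is `c^m · γ`.** [this work] -/
theorem transformA_gridArr_eq {m n : ℕ} (hn : 0 < n) {H : Fin (n + 1) → Fin (n + 1) → ℤ} {c : ℤ} (hH : checkH n H c = true)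
    (A : Fin n → Set (Set (Fin m))) (hsym : symFam m n (fun i => encA m (A i)) = true) (K : Fin m → Fin (n + 1)) :
    (transformA n H m (gridArr m n (fun i => encA m (A i)))).getD (enc K) 0 = c ^ m * sahiCoef m n (fun i => encA m (A i)) K := by
  rw [transformA_eq, ← interp_identity (checkH_spec hH)]
  exact Finset.sum_congr rfl fun x _ => by rw [gridArr_eq_sum hn A hsym x]

/-- **SOUNDNESS OF THE INTERPOLATION LEAF TEST**: a passing `testI` on the bitmasks of a family of events of `Set (Fin m)` gives
`E_n(μ_p; 1_{A_0}, …, 1_{A_{n−1}}) ≥ 0` for EVERY product weight `μ_p` — the shape required of a leaf test by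
…`SahiSymCubeSound.sahiPositive_of_symCheckT`. [this work] -/
theorem testI_sound {m n : ℕ} {H : Fin (n + 1) → Fin (n + 1) → ℤ} {c : ℤ} (A : Fin n → Set (Set (Fin m)))
    (h : testI m n H c (fun i => encA m (A i)) = true) (p : Fin m → unitInterval) :
    0 ≤ sahiE (bernoulliWeight p) n (fun i => ind (A i)) := by
  unfold testI at h
  simp only [Bool.and_eq_true, decide_eq_true_eq] at h
  obtain ⟨⟨⟨⟨hn, hc⟩, hH⟩, hsym⟩, hall⟩ := h
  rw [Array.all_eq_true] at hall
  have hγ : ∀ K, 0 ≤ sahiCoef m n (fun i => encA m (A i)) K := by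
    intro K
    have hsize := size_transformA n H m (gridArr m n (fun i => encA m (A i)))
    have hK : enc K < (transformA n H m (gridArr m n (fun i => encA m (A i)))).size := by rw [hsize]; exact enc_lt K
    have h1 := hall (enc K) hK
    rw [decide_eq_true_eq] at h1
    have h2 : (transformA n H m (gridArr m n (fun i => encA m (A i)))).getD (enc K) 0 =
        (transformA n H m (gridArr m n (fun i => encA m (A i))))[enc K] := by
      rw [Array.getD_eq_getD_getElem?, Array.getElem?_eq_getElem hK, Option.getD_some]
    rw [← h2, transformA_gridArr_eq hn hH A hsym K] at h1
    exact (mul_nonneg_iff_of_pos_left (pow_pos hc m)).1 h1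
  rw [← evB_sahiCoef]
  exact evB_nonneg hγ fun i => ⟨(p i).2.1, (p i).2.2⟩

end Sound

end Summit.CriticalPhenomena.PercolationContinuityZ3.Theorems.SahiInterp
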